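import Literature.Dynamics.NBody.AlbouyKaloshin2012Sec892

/-!
# The unprinted mass polynomials of Albouy–Kaloshin 2012, §8.2 (pp. 573–575), made explicit

Topic `Literature/Dynamics/NBody`; companion of `AlbouyKaloshin2012Sec892.lean` for the `pub-smale6` cell.
[AlbouyKaloshin2012] §8.2 reduces diagram 2 of Fig. 11 to a complex three-body central configuration of
the masses `m₃, m₄, m₅` (appendix pp. 583–586: the eight factors `S₁ … S₈(w₃,w₄,w₅)`, typed verbatim in
`AlbouyKaloshin2012Appendix.lean`) constrained by one further equation: `A = 0` of (25) in case 8.2.1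
("same three signs"), or (28) `A y² + 2B y + (C − A)/2 = 0` in case 8.2.2, with `y = (x + x⁻¹)/2`,
`x = i µ₂³/µ₁³`, `m₁ = µ₁²`, `m₂ = µ₂²`. The paper prints the resulting mass polynomials by their degree,
term count and one or two leading terms only: `L₁ … L₈, L₅′` (p. 574: degrees 36,36,36,22,(2,12),28,28,28;
"563 other terms"), `K_k = P_k(0)` (p. 575: degrees 40,40,40,24,16,32,32,32; term counts 861,861,861,321,
143,559,559,557), and the `y`-polynomials `P_k(y)` (p. 575: `deg_y` 10,10,10,6,4,8,8,8).

The tables live in the part files `AlbouyKaloshin2012Sec82A…D.lean` (k = 1,2 | 3,4 | 5,6 | 7,8; one file per pair so that each elaborates in minutes) and are the cell's RECOMPUTATION: with the line `m₃w₃ + m₄w₄ + m₅w₅ = 0` parametrised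
as `(w₃,w₄,w₅) = (−(m₄u + m₅v), m₃u, m₃v)` and dehomogenised at `v = 1`,
`L_k` = the mass factor of `Res_u(S_k|line, w₃²w₄²w₅²·A|line)` and `K_k` = the mass factor of the printed
degree of `P_k(0)`, `P_k(y)` = the `y`-dependent factor of `Res_u(S_k|line, w₃²w₄²w₅²·(2A y² + 4B y + C − A)|line)`,
computed EXACTLY over `ℤ` by a standard-library Python engine (Sylvester determinants by a division-free
dynamic programme; factors identified by exact division after stripping `m₃^a (m₃+m₄+m₅)^b`, no factoriser),
with the dehomogenisation `u = 1` as a consistency run (all 25 canonical texts byte-identical). Certificate: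
`run/shared/lean/pub/pub-smale6/certs/ak82-stdlib/` (referee gen 12; per-polynomial sha256 in `MANIFEST.json`,
repeated in the docstrings below). SECOND ENGINE (seat 1 gen 3, 2026-08-19, `certs/ak82-interp/`): an
algorithmically independent standard-library recomputation — at every integer grid point `(m₃,m₄,m₅,y) = (1,a,b,c)`
the restricted `S_k`, `A`, `P` are built as integer univariate polynomials in `u`, `Res_u` is the integer
determinant of the formal-size Sylvester matrix (fraction-free Bareiss), and the resultant polynomials are
recovered by nested exact Newton interpolation and re-homogenised in `m₃` (run aborts on a non-integral
coefficient; off-grid re-check at random points), followed by the same exact-division identification —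
reproduces ALL 25 canonical texts byte-for-byte in both dehomogenisations `v = 1` and `u = 1`
(`certs/ak82-interp/code/compare_manifests.py`: 25/25 equal sha256 each). Two independent implementations therefore agree on every table below; what they share is only the
INPUT (the appendix transcription `S₁…S₈`, `A, B, C` of (25)–(27), the line parametrisation) and the
identification conventions.

STATUS OF THE IDENTIFICATION: as for `F892`, a table IS the printed polynomial only by the printed
cross-checks (degree, term count, the printed coefficients — up to one global sign, which the canonical
form fixes as "leading coefficient positive" — and the stated symmetries), re-checked by the kernel in
`*_printed_data`; it is a recomputation (two agreeing engines; irreducibility of the cofactors NOT checked), not a transcription.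

What this makes explicit: the constituents `{m_i = m_j} ∩ {K_k(m_k, m_l, m_r) = 0}` of 8.2.2.1 (p. 575,
`Rel8221`), which are codimension-2 pieces of the exceptional set `A` of Theorem 2 (proof of Theorem 6,
p. 582 (i)), and parts (ii) of the Remark-7 certificate of the Example p. 583: `L_k ≠ 0` on the
Example masses under every renumbering (`avoidsAK82_L<k>_example12345`). Integer arithmetic only.
-/

namespace Literature.Dynamics.NBody

/-- One term `c · m₃^a m₄^b m₅^c` of a three-mass table. [cite: AlbouyKaloshin2012, §8.2 pp. 574–575] -/
def Term3 {R : Type*} [CommRing R] (m3 m4 m5 : R) (t : ℤ × ℕ × ℕ × ℕ) : R :=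
  (t.1 : R) * m3 ^ t.2.1 * m4 ^ t.2.2.1 * m5 ^ t.2.2.2

/-- Evaluation of a three-mass table. [cite: AlbouyKaloshin2012, §8.2 pp. 574–575] -/
def evalTable3 {R : Type*} [CommRing R] (T : List (ℤ × ℕ × ℕ × ℕ)) (m3 m4 m5 : R) : R :=
  (T.map (Term3 m3 m4 m5)).sum

/-- Relation 8.2.2.1 of [AlbouyKaloshin2012] p. 575 for the `k`-th three-body class: two equal masses `m_i = m_j`
and `K_k` vanishing on the remaining three (an arbitrary index tuple — "under any renumbering" is "for all
pairwise distinct indices"). These are explicit codimension-2 constituents of the exceptional set `A`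
(proof of Theorem 6, p. 582 (i)). [cite: AlbouyKaloshin2012, §8.2.2.1 p. 575; p. 582] -/
def Rel8221 (K : ℝ → ℝ → ℝ → ℝ) (m : Fin 5 → ℝ) (i j k l r : Fin 5) : Prop :=
  m i = m j ∧ K (m k) (m l) (m r) = 0

/-- Relation 8.2.1 of [AlbouyKaloshin2012] p. 574: `L_k` vanishes on three of the masses.
[cite: AlbouyKaloshin2012, §8.2.1 p. 574] -/
def Rel821 (L : ℝ → ℝ → ℝ → ℝ) (m : Fin 5 → ℝ) (k l r : Fin 5) : Prop := L (m k) (m l) (m r) = 0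

/-- Casting an integer table evaluation to `ℝ`. [folklore] -/
theorem evalTable3_cast (T : List (ℤ × ℕ × ℕ × ℕ)) (a b c : ℤ) :
    ((evalTable3 T a b c : ℤ) : ℝ) = evalTable3 T (a : ℝ) (b : ℝ) (c : ℝ) := by
  unfold evalTable3
  rw [Int.cast_list_sum, List.map_map]
  congr 1
  apply List.map_congr_left
  intro t _
  simp only [Function.comp, Term3]
  push_cast
  ring

end Literature.Dynamics.NBody
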